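import Literature.Topology.FourManifolds.CircleNormalFraming
import Literature.Geometry.Kaehler.ManifoldFormsPullback
import HarnessLib

/-!
# A differential form read in the ambient space of an immersion (the "ambient form")

Topic `Literature/Geometry/Manifold`; infrastructure for the symplectic tubular neighbourhood of
a symplectic surface (McLean, *The growth rate of symplectic homology and affine varieties*,
GAFA 2012, Lemma 5.14, `k = 1`; fact seat of
`Literature.Geometry.Symplectic.mclean_divisorComplement_convex_four`), following the tree's
bundle-free treatment of tubular neighbourhoods through a Whitney embedding
(`Literature/Topology/FourManifolds/NormalRetraction.lean`: Hirsch, *Differential Topology*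
(1976), Ch. 4 §5 — everything phrased with the smooth field of tangent planes
`T_x = de(T_x X) ⊆ V` of a map `e : X → V` into an inner product space).

For `e : X → V` with injective differential and a `k`-form `α` on `X`
(`Literature.Geometry.Kaehler.MForm`) we define the **ambient form** `α.ambient e x`, the
continuous alternating `k`-form on `V` which is `α x` on the tangent plane, `T_x`, read through
`de_x`, and which vanishes as soon as one argument is normal to `T_x`:

* the Gram left inverse `leftInv A = (A†A)⁻¹ A†` of an injective `A : E →L V` is the tree's
  `Literature.Topology.FourManifolds.leftInv` (`CircleNormalFraming.lean`: `leftInv_apply_self`,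
  `self_leftInv_apply`, `contDiffAt_leftInv`); here we add that it kills `(range A)ᗮ`
  (`leftInv_apply_eq_zero_of_mem_orthogonal`), its characterisation by these two properties
  (`eq_leftInv`) and the rule `leftInv (A ∘ G) = G⁻¹ ∘ leftInv A` (`leftInv_comp_equiv`);
* `MForm.ambientAux α e p y` — `α` read in the chart at `p` and pushed to `V` by the Gram left
  inverse of the chart derivative `D(e ∘ φ_p⁻¹)(y)`; `MForm.ambient α e x` — the same in the
  chart at `x` itself;
* `MForm.ambient_apply_mfderiv` — `α.ambient e x (de_x ∘ v) = α x v`;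
  `MForm.ambient_comp_tangentProj` — `α.ambient e x` factors through the tangent projection;
  `MForm.ambientAux_eq_ambient` — chart independence; whence
* `MForm.contMDiff_ambient` — **for smooth `α` and a smooth `e` with injective differential,
  `x ↦ α.ambient e x` is a `C^∞` map `X → V [⋀^Fin k]→L[ℝ] F`** (so that data built from a
  `2`-form along a submanifold — symplectic orthogonals, orientations, rotations — become smooth
  fields of linear-algebra objects on the fixed space `V`).

Everything here is proved; no named facts (D-0026).

## References

* M. W. Hirsch, *Differential Topology*, GTM 33 (1976), Ch. 4 §5. [HirschDT1976]
* F. W. Warner, *Foundations of Differentiable Manifolds and Lie Groups* (1983), 2.18, 2.22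
  (local representatives of forms). [Warner1983]
-/

noncomputable section

open scoped Manifold ContDiff Topology RealInnerProductSpace
open Set Function
open Literature.Topology.FourManifolds
open Literature.Geometry.Kaehler

namespace Literature.Geometry.Manifold

/-! ### The Gram left inverse of an injective linear map -/

section Gram

variable {E V : Type*} [NormedAddCommGroup E] [InnerProductSpace ℝ E] [FiniteDimensional ℝ E]
  [NormedAddCommGroup V] [InnerProductSpace ℝ V] [FiniteDimensional ℝ V]

/-- The adjoint kills the orthogonal complement of the range. [folklore] -/
theorem adjoint_apply_eq_zero_of_mem_orthogonal (A : E →L[ℝ] V) {v : V}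
    (hv : v ∈ (LinearMap.range A.toLinearMap)ᗮ) : ContinuousLinearMap.adjoint A v = 0 := by
  apply ext_inner_right ℝ
  intro u
  rw [ContinuousLinearMap.adjoint_inner_left, inner_zero_left]
  exact Submodule.inner_left_of_mem_orthogonal (K := LinearMap.range A.toLinearMap) ⟨u, rfl⟩ hv

/-- **The Gram left inverse kills the normal space** `(range A)ᗮ`. [folklore] -/
theorem leftInv_apply_eq_zero_of_mem_orthogonal (A : E →L[ℝ] V) {v : V}
    (hv : v ∈ (LinearMap.range A.toLinearMap)ᗮ) : leftInv A v = 0 := by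
  rw [leftInv, ContinuousLinearMap.comp_apply, adjoint_apply_eq_zero_of_mem_orthogonal A hv, map_zero]

/-- `v - gramProj A v` is normal to the range of `A` (restated with the range as a submodule).
[folklore] -/
theorem sub_gramProj_mem_orthogonal {A : E →L[ℝ] V} (hA : Injective A) (v : V) :
    v - gramProj A v ∈ (LinearMap.range A.toLinearMap)ᗮ := by
  rw [Submodule.mem_orthogonal']
  rintro _ ⟨u, rfl⟩
  exact inner_sub_gramProj_apply hA v u

/-- **Characterisation of the Gram left inverse**: a linear map `V → E` which is a left inverse of
the injective `A` and kills `(range A)ᗮ` is `leftInv A` (decompose `v = A (leftInv A v) +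
(v - gramProj A v)`). [folklore] -/
theorem eq_leftInv {A : E →L[ℝ] V} (hA : Injective A) {L : V →L[ℝ] E}
    (h1 : ∀ u, L (A u) = u) (h2 : ∀ v ∈ (LinearMap.range A.toLinearMap)ᗮ, L v = 0) :
    L = leftInv A := by
  ext v
  have hv : v = A (leftInv A v) + (v - gramProj A v) := by
    rw [self_leftInv_apply]; abel
  have hL : L v = L (A (leftInv A v) + (v - gramProj A v)) := congrArg L hv
  rw [hL, map_add, h1, h2 _ (sub_gramProj_mem_orthogonal hA v), add_zero]

/-- **The Gram left inverse of `A ∘ G` for an automorphism `G`** is `G⁻¹ ∘ leftInv A`.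
[folklore] -/
theorem leftInv_comp_equiv {A : E →L[ℝ] V} (hA : Injective A) (G : E ≃L[ℝ] E) :
    leftInv (A.comp (G : E →L[ℝ] E)) = (G.symm : E →L[ℝ] E).comp (leftInv A) := by
  have hAG : Injective (A.comp (G : E →L[ℝ] E)) := hA.comp G.injective
  have hrange : LinearMap.range (A.comp (G : E →L[ℝ] E)).toLinearMap =
      LinearMap.range A.toLinearMap := by
    ext v
    constructor
    · rintro ⟨u, rfl⟩; exact ⟨G u, rfl⟩
    · rintro ⟨u, rfl⟩; exact ⟨G.symm u, by simp⟩
  symm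
  refine eq_leftInv hAG (fun u ↦ ?_) (fun v hv ↦ ?_)
  · rw [ContinuousLinearMap.comp_apply, ContinuousLinearMap.comp_apply,
      ContinuousLinearEquiv.coe_coe, ContinuousLinearEquiv.coe_coe, leftInv_apply_self hA,
      G.symm_apply_apply]
  · rw [hrange] at hv
    rw [ContinuousLinearMap.comp_apply, leftInv_apply_eq_zero_of_mem_orthogonal A hv, map_zero]

end Gram

/-! ### The ambient form of a form along an immersion -/

section Ambient

variable {m : ℕ} {X : Type*} [TopologicalSpace X] [ChartedSpace (EuclideanSpace ℝ (Fin m)) X]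
  {V : Type*} [NormedAddCommGroup V] [InnerProductSpace ℝ V] [FiniteDimensional ℝ V]
  {F : Type*} [NormedAddCommGroup F] [NormedSpace ℝ F] {k : ℕ}

/-- The ambient form of `α` along `e`, **read in the chart at `p`**: at a chart point `y`, the
representative `α.inChart p y` pushed to `V` along the Gram left inverse of the chart derivative
`D(e ∘ φ_p⁻¹)(y)`. [folklore] -/
def _root_.Literature.Geometry.Kaehler.MForm.ambientAux (α : MForm (𝓡 m) X F k) (e : X → V)
    (p : X) (y : EuclideanSpace ℝ (Fin m)) : V [⋀^Fin k]→L[ℝ] F :=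
  (α.inChart p y).compContinuousLinearMap (leftInv (chartDeriv (𝓡 m) e p y))

/-- The **ambient form** of `α` along `e : X → V` at `x`: the `k`-form on `V` equal to `α x` on the
tangent plane `de(T_x X)` (read through `de_x`) and vanishing as soon as one argument is normal
to it (`ambientAux` in the chart at `x` itself). [folklore] -/
def _root_.Literature.Geometry.Kaehler.MForm.ambient (α : MForm (𝓡 m) X F k) (e : X → V)
    (x : X) : V [⋀^Fin k]→L[ℝ] F :=
  α.ambientAux e x (extChartAt (𝓡 m) x x)

/-- Unfolding of `MForm.ambientAux`. [folklore] -/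
theorem _root_.Literature.Geometry.Kaehler.MForm.ambientAux_apply (α : MForm (𝓡 m) X F k)
    (e : X → V) (p : X) (y : EuclideanSpace ℝ (Fin m)) (u : Fin k → V) :
    α.ambientAux e p y u =
      α.inChart p y (fun i ↦ leftInv (chartDeriv (𝓡 m) e p y) (u i)) := rfl

/-- Unfolding of `MForm.ambient`. [folklore] -/
theorem _root_.Literature.Geometry.Kaehler.MForm.ambient_eq (α : MForm (𝓡 m) X F k) (e : X → V)
    (x : X) : α.ambient e x = α.ambientAux e x (extChartAt (𝓡 m) x x) := rfl

variable [IsManifold (𝓡 m) ∞ X]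

/-- The differential of the extended chart at `p` at a point `x` of its source is the tangent
coordinate change from the chart at `x` to the chart at `p` (Mathlib's
`mfderiv_chartAt_eq_tangentCoordChange`; for the self-model the extended chart is the chart).
[folklore] -/
theorem mfderiv_extChartAt_eq_tangentCoordChange {p x : X}
    (hx : x ∈ (extChartAt (𝓡 m) p).source) :
    mfderiv (𝓡 m) 𝓘(ℝ, EuclideanSpace ℝ (Fin m)) (extChartAt (𝓡 m) p) x =
      tangentCoordChange (𝓡 m) x p x := by
  rw [extChartAt_source] at hx
  rw [← mfderiv_chartAt_eq_tangentCoordChange (I := 𝓡 m) hx]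
  rfl

/-- The tangent coordinate change back to the chart at `x`, applied after the derivative of the
chart at `p`, is the identity on `T_x X` (cocycle `tangentCoordChange_comp`). [folklore] -/
theorem tangentCoordChange_mfderiv_extChartAt {p x : X} (hx : x ∈ (extChartAt (𝓡 m) p).source)
    (w : TangentSpace (𝓡 m) x) :
    tangentCoordChange (𝓡 m) p x x
      (mfderiv (𝓡 m) 𝓘(ℝ, EuclideanSpace ℝ (Fin m)) (extChartAt (𝓡 m) p) x w) = w := by
  rw [mfderiv_extChartAt_eq_tangentCoordChange hx]
  exact (tangentCoordChange_comp (I := 𝓡 m)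
    ⟨⟨mem_extChartAt_source x, hx⟩, mem_extChartAt_source x⟩).trans
    (tangentCoordChange_self (mem_extChartAt_source x))

/-- **The ambient form read in any chart evaluates `α` on tangent vectors**: for `x` in the
domain of the chart at `p`, `α.ambientAux e p (φ_p x) (de_x ∘ v) = α x v`. [folklore] -/
theorem _root_.Literature.Geometry.Kaehler.MForm.ambientAux_apply_mfderiv (α : MForm (𝓡 m) X F k)
    {e : X → V} {p x : X} (hx : x ∈ (extChartAt (𝓡 m) p).source)
    (he : MDifferentiableAt (𝓡 m) 𝓘(ℝ, V) e x) (hinj : Injective (mfderiv (𝓡 m) 𝓘(ℝ, V) e x))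
    (v : Fin k → TangentSpace (𝓡 m) x) :
    α.ambientAux e p (extChartAt (𝓡 m) p x) (fun i ↦ mfderiv (𝓡 m) 𝓘(ℝ, V) e x (v i)) =
      α x v := by
  have hy : extChartAt (𝓡 m) p x ∈ (extChartAt (𝓡 m) p).target :=
    (extChartAt (𝓡 m) p).map_source hx
  have hxx : (extChartAt (𝓡 m) p).symm (extChartAt (𝓡 m) p x) = x :=
    (extChartAt (𝓡 m) p).left_inv hx
  have hC := mfderiv_eq_chartDeriv_comp (I := 𝓡 m) hx he
  have hCinj : Injective (chartDeriv (𝓡 m) e p (extChartAt (𝓡 m) p x)) :=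
    injective_chartDeriv hx he hinj
  have key : ∀ i, leftInv (chartDeriv (𝓡 m) e p (extChartAt (𝓡 m) p x))
      (mfderiv (𝓡 m) 𝓘(ℝ, V) e x (v i)) =
        mfderiv (𝓡 m) 𝓘(ℝ, EuclideanSpace ℝ (Fin m)) (extChartAt (𝓡 m) p) x (v i) := fun i ↦ by
    have h1 : mfderiv (𝓡 m) 𝓘(ℝ, V) e x (v i) = chartDeriv (𝓡 m) e p (extChartAt (𝓡 m) p x)
        (mfderiv (𝓡 m) 𝓘(ℝ, EuclideanSpace ℝ (Fin m)) (extChartAt (𝓡 m) p) x (v i)) := by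
      rw [hC]; rfl
    rw [h1, leftInv_apply_self hCinj]
  rw [MForm.ambientAux_apply, α.inChart_eq_of_mem_target hy, hxx]
  simp only [ContinuousAlternatingMap.compContinuousLinearMap_apply, Function.comp_def, key]
  exact congrArg (α x) (funext fun i ↦ tangentCoordChange_mfderiv_extChartAt hx (v i))

/-- **The ambient form evaluates `α` on tangent vectors**: `α.ambient e x (de_x ∘ v) = α x v`.
[folklore] -/
theorem _root_.Literature.Geometry.Kaehler.MForm.ambient_apply_mfderiv (α : MForm (𝓡 m) X F k)
    {e : X → V} {x : X} (he : MDifferentiableAt (𝓡 m) 𝓘(ℝ, V) e x)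
    (hinj : Injective (mfderiv (𝓡 m) 𝓘(ℝ, V) e x)) (v : Fin k → TangentSpace (𝓡 m) x) :
    α.ambient e x (fun i ↦ mfderiv (𝓡 m) 𝓘(ℝ, V) e x (v i)) = α x v :=
  α.ambientAux_apply_mfderiv (mem_extChartAt_source x) he hinj v

/-- The Gram left inverse of the chart derivative kills the normal space `T_xᗮ`. [folklore] -/
theorem leftInv_chartDeriv_apply_eq_zero {e : X → V} {p x : X}
    (hx : x ∈ (extChartAt (𝓡 m) p).source) (he : MDifferentiableAt (𝓡 m) 𝓘(ℝ, V) e x) {u : V}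
    (hu : u ∈ (tangentPlane (𝓡 m) e x)ᗮ) :
    leftInv (chartDeriv (𝓡 m) e p (extChartAt (𝓡 m) p x)) u = 0 := by
  apply leftInv_apply_eq_zero_of_mem_orthogonal
  rwa [← tangentPlane_eq_range_chartDeriv hx he]

/-- **The ambient form vanishes as soon as one argument is normal** to the tangent plane.
[folklore] -/
theorem _root_.Literature.Geometry.Kaehler.MForm.ambientAux_apply_eq_zero_of_mem_orthogonal
    (α : MForm (𝓡 m) X F k) {e : X → V} {p x : X} (hx : x ∈ (extChartAt (𝓡 m) p).source)
    (he : MDifferentiableAt (𝓡 m) 𝓘(ℝ, V) e x) {u : Fin k → V} {i : Fin k}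
    (hu : u i ∈ (tangentPlane (𝓡 m) e x)ᗮ) :
    α.ambientAux e p (extChartAt (𝓡 m) p x) u = 0 := by
  rw [MForm.ambientAux_apply]
  exact ContinuousAlternatingMap.map_coord_zero _ i
    (leftInv_chartDeriv_apply_eq_zero hx he hu)

/-- **The ambient form factors through the tangent projection**:
`α.ambientAux e p (φ_p x) (P_x ∘ u) = α.ambientAux e p (φ_p x) u`. [folklore] -/
theorem _root_.Literature.Geometry.Kaehler.MForm.ambientAux_apply_tangentProj
    (α : MForm (𝓡 m) X F k) {e : X → V} {p x : X} (hx : x ∈ (extChartAt (𝓡 m) p).source)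
    (he : MDifferentiableAt (𝓡 m) 𝓘(ℝ, V) e x) (hinj : Injective (mfderiv (𝓡 m) 𝓘(ℝ, V) e x))
    (u : Fin k → V) :
    α.ambientAux e p (extChartAt (𝓡 m) p x) (fun i ↦ tangentProj (𝓡 m) e x (u i)) =
      α.ambientAux e p (extChartAt (𝓡 m) p x) u := by
  have hCinj : Injective (chartDeriv (𝓡 m) e p (extChartAt (𝓡 m) p x)) :=
    injective_chartDeriv hx he hinj
  simp only [MForm.ambientAux_apply]
  congr 1
  funext i
  rw [tangentProj_eq_gramProj_chartDeriv hx he hinj, ← self_leftInv_apply, leftInv_apply_self hCinj]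

/-- **Chart independence of the push-forward map**: for `x` in the domain of the chart at `p`,
the Gram left inverse of the chart derivative at `p`, followed by the tangent coordinate change to
the chart at `x`, is the Gram left inverse of the chart derivative at `x` (both are left inverses
of `de_x` killing the normal space). [folklore] -/
theorem tangentCoordChange_comp_leftInv_chartDeriv {e : X → V} {p x : X}
    (hx : x ∈ (extChartAt (𝓡 m) p).source) (he : MDifferentiableAt (𝓡 m) 𝓘(ℝ, V) e x)
    (hinj : Injective (mfderiv (𝓡 m) 𝓘(ℝ, V) e x)) :
    (tangentCoordChange (𝓡 m) p x x).comp
        (leftInv (chartDeriv (𝓡 m) e p (extChartAt (𝓡 m) p x))) =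
      leftInv (chartDeriv (𝓡 m) e x (extChartAt (𝓡 m) x x)) := by
  have hx₀ : x ∈ (extChartAt (𝓡 m) x).source := mem_extChartAt_source x
  have hCp := mfderiv_eq_chartDeriv_comp (I := 𝓡 m) hx he
  have hCx := mfderiv_eq_chartDeriv_comp (I := 𝓡 m) hx₀ he
  have hCpinj : Injective (chartDeriv (𝓡 m) e p (extChartAt (𝓡 m) p x)) :=
    injective_chartDeriv hx he hinj
  have hCxinj : Injective (chartDeriv (𝓡 m) e x (extChartAt (𝓡 m) x x)) :=
    injective_chartDeriv hx₀ he hinj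
  refine eq_leftInv hCxinj (fun a ↦ ?_) (fun w hw ↦ ?_)
  · -- `chartDeriv x (φ_x x) a = de_x a = chartDeriv p (φ_p x) (Dφ_p a)`
    have h1 : chartDeriv (𝓡 m) e x (extChartAt (𝓡 m) x x) a = mfderiv (𝓡 m) 𝓘(ℝ, V) e x a := by
      rw [mfderiv_extChartAt_self] at hCx
      exact (DFunLike.congr_fun hCx a).symm
    have h2 : mfderiv (𝓡 m) 𝓘(ℝ, V) e x a = chartDeriv (𝓡 m) e p (extChartAt (𝓡 m) p x)
        (mfderiv (𝓡 m) 𝓘(ℝ, EuclideanSpace ℝ (Fin m)) (extChartAt (𝓡 m) p) x a) := by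
      rw [hCp]; rfl
    rw [ContinuousLinearMap.comp_apply, h1, h2, leftInv_apply_self hCpinj]
    exact tangentCoordChange_mfderiv_extChartAt hx a
  · have hw' : w ∈ (tangentPlane (𝓡 m) e x)ᗮ := by
      rwa [tangentPlane_eq_range_chartDeriv hx₀ he]
    rw [ContinuousLinearMap.comp_apply, leftInv_chartDeriv_apply_eq_zero hx he hw', map_zero]

/-- **Chart independence of the ambient form**: for `x` in the domain of the chart at `p`,
`α.ambientAux e p (φ_p x) = α.ambient e x`. [folklore] -/
theorem _root_.Literature.Geometry.Kaehler.MForm.ambientAux_eq_ambient (α : MForm (𝓡 m) X F k)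
    {e : X → V} {p x : X} (hx : x ∈ (extChartAt (𝓡 m) p).source)
    (he : MDifferentiableAt (𝓡 m) 𝓘(ℝ, V) e x) (hinj : Injective (mfderiv (𝓡 m) 𝓘(ℝ, V) e x)) :
    α.ambientAux e p (extChartAt (𝓡 m) p x) = α.ambient e x := by
  have hy : extChartAt (𝓡 m) p x ∈ (extChartAt (𝓡 m) p).target :=
    (extChartAt (𝓡 m) p).map_source hx
  have hxx : (extChartAt (𝓡 m) p).symm (extChartAt (𝓡 m) p x) = x :=
    (extChartAt (𝓡 m) p).left_inv hx
  have hL := tangentCoordChange_comp_leftInv_chartDeriv hx he hinj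
  ext u
  rw [MForm.ambient_eq, MForm.ambientAux_apply, MForm.ambientAux_apply,
    α.inChart_eq_of_mem_target hy, MForm.inChart_apply_self, hxx]
  simp only [ContinuousAlternatingMap.compContinuousLinearMap_apply, Function.comp_def]
  congr 1
  funext i
  rw [← hL]
  rfl

/-- **The ambient form factors through the tangent projection** (chart at the point). [folklore] -/
theorem _root_.Literature.Geometry.Kaehler.MForm.ambient_apply_tangentProj (α : MForm (𝓡 m) X F k)
    {e : X → V} {x : X} (he : MDifferentiableAt (𝓡 m) 𝓘(ℝ, V) e x)
    (hinj : Injective (mfderiv (𝓡 m) 𝓘(ℝ, V) e x)) (u : Fin k → V) :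
    α.ambient e x (fun i ↦ tangentProj (𝓡 m) e x (u i)) = α.ambient e x u :=
  α.ambientAux_apply_tangentProj (mem_extChartAt_source x) he hinj u

/-- **The ambient form vanishes as soon as one argument is normal** (chart at the point).
[folklore] -/
theorem _root_.Literature.Geometry.Kaehler.MForm.ambient_apply_eq_zero_of_mem_orthogonal
    (α : MForm (𝓡 m) X F k) {e : X → V} {x : X} (he : MDifferentiableAt (𝓡 m) 𝓘(ℝ, V) e x)
    {u : Fin k → V} {i : Fin k} (hu : u i ∈ (tangentPlane (𝓡 m) e x)ᗮ) : α.ambient e x u = 0 :=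
  α.ambientAux_apply_eq_zero_of_mem_orthogonal (mem_extChartAt_source x) he hu

/-- **The ambient form read in a chart is `C^∞` on the chart target**, for smooth `α` and smooth
`e` with injective differential. [folklore] -/
theorem _root_.Literature.Geometry.Kaehler.MForm.contDiffOn_ambientAux {α : MForm (𝓡 m) X F k}
    (hα : IsSmoothForm α) {e : X → V} (he : ContMDiff (𝓡 m) 𝓘(ℝ, V) ∞ e)
    (hinj : ∀ x, Injective (mfderiv (𝓡 m) 𝓘(ℝ, V) e x)) (p : X) :
    ContDiffOn ℝ ∞ (α.ambientAux e p) (extChartAt (𝓡 m) p).target := by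
  intro y hy
  have hmd : ∀ x, MDifferentiableAt (𝓡 m) 𝓘(ℝ, V) e x := fun x ↦ (he x).mdifferentiableAt (by simp)
  have hy' : (extChartAt (𝓡 m) p).symm y ∈ (extChartAt (𝓡 m) p).source :=
    (extChartAt (𝓡 m) p).map_target hy
  have hinj' : Injective (chartDeriv (𝓡 m) e p y) := by
    have := injective_chartDeriv hy' (hmd _) (hinj ((extChartAt (𝓡 m) p).symm y))
    rwa [(extChartAt (𝓡 m) p).right_inv hy] at this
  have h1 : ContDiffWithinAt ℝ ∞ (α.inChart p) (extChartAt (𝓡 m) p).target y := by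
    have h := MForm.SmoothAt.contDiffWithinAt_inChart (x₀ := p) hy'
      ((isSmoothForm_iff_smoothAt α).1 hα ((extChartAt (𝓡 m) p).symm y))
    rw [(extChartAt (𝓡 m) p).right_inv hy, ModelWithCorners.Boundaryless.range_eq_univ] at h
    exact h.mono (subset_univ _)
  have h2 : ContDiffWithinAt ℝ ∞ (fun y ↦ leftInv (chartDeriv (𝓡 m) e p y))
      (extChartAt (𝓡 m) p).target y :=
    (contDiffAt_leftInv hinj').comp_contDiffWithinAt y (contDiffOn_chartDeriv he p y hy)
  exact Literature.NumberTheory.Transcendental.ContDiffWithinAt.continuousAlternatingMapCompContinuousLinearMap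
    h1 h2

/-- **The ambient form of a smooth form along a smooth immersion is a `C^∞` field**
`X → V [⋀^Fin k]→L[ℝ] F`. [folklore] -/
theorem _root_.Literature.Geometry.Kaehler.MForm.contMDiff_ambient {α : MForm (𝓡 m) X F k}
    (hα : IsSmoothForm α) {e : X → V} (he : ContMDiff (𝓡 m) 𝓘(ℝ, V) ∞ e)
    (hinj : ∀ x, Injective (mfderiv (𝓡 m) 𝓘(ℝ, V) e x)) :
    ContMDiff (𝓡 m) 𝓘(ℝ, V [⋀^Fin k]→L[ℝ] F) ∞ (α.ambient e) := by
  intro p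
  have hmd : ∀ x, MDifferentiableAt (𝓡 m) 𝓘(ℝ, V) e x := fun x ↦ (he x).mdifferentiableAt (by simp)
  have heq : ∀ x ∈ (extChartAt (𝓡 m) p).source,
      α.ambient e x = (α.ambientAux e p ∘ extChartAt (𝓡 m) p) x := fun x hx ↦
    (α.ambientAux_eq_ambient hx (hmd x) (hinj x)).symm
  have h2 : ContMDiffOn (𝓡 m) 𝓘(ℝ, V [⋀^Fin k]→L[ℝ] F) ∞ (α.ambientAux e p ∘ extChartAt (𝓡 m) p)
      (extChartAt (𝓡 m) p).source := by
    have hφ : ContMDiffOn (𝓡 m) 𝓘(ℝ, EuclideanSpace ℝ (Fin m)) ∞ (extChartAt (𝓡 m) p)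
        (extChartAt (𝓡 m) p).source := by
      rw [extChartAt_source]; exact contMDiffOn_extChartAt
    exact (MForm.contDiffOn_ambientAux hα he hinj p).contMDiffOn.comp hφ
      fun x hx ↦ (extChartAt (𝓡 m) p).map_source hx
  exact (h2.congr heq).contMDiffAt (extChartAt_source_mem_nhds p)

/-- The ambient form of a smooth form along a smooth immersion is continuous. [folklore] -/
theorem _root_.Literature.Geometry.Kaehler.MForm.continuous_ambient {α : MForm (𝓡 m) X F k}
    (hα : IsSmoothForm α) {e : X → V} (he : ContMDiff (𝓡 m) 𝓘(ℝ, V) ∞ e)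
    (hinj : ∀ x, Injective (mfderiv (𝓡 m) 𝓘(ℝ, V) e x)) : Continuous (α.ambient e) :=
  (MForm.contMDiff_ambient hα he hinj).continuous

end Ambient

end Literature.Geometry.Manifold
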